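import Mathlib.Data.Nat.Choose.Basic
import Mathlib.Data.List.Basic

/-!
# Kernel-checked certificates for rows of the kangaroo atlas (resolution observatory, `pub-rosobs`)

A third, independent implementation of the classical pair `(order, shade)` for purely inseparable
hypersurfaces `x^q + F(y₁,…,y_m)` over `𝔽_p` under point blow-ups — computable, over sparse
exponent lists, so that a scripted path of blow-ups is re-checked by `decide` (kernel reduction).
It certifies the PRINTED paths reproduced by the atlas' two Python engines:

* Hauser 2010 (BAMS 47, §G, p. 19) / Hauser 2003 §14 Example 2: `f = x² + y⁷ + yz⁴`, `p = 2`;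
  shades `5, 2, 2, 3` along `(xy, y, zy)`, `(xz, yz, z)`, `(xz, yz + z, z)` — the increase
  `2 → 3` at the kangaroo point after the cleaning `x ↦ x + yz³` [cite: Hauser2010, §G];
* the two prescribed-history zoo rows of the atlas (`iso-p2-y3z+yz3-r11`, `iso-p3-r12`) whose
  antelope has an isolated coordinate top locus;
* Moh's bound (`shade' ≤ shade + p^(e−1)`, [cite: Moh1987, Stability Theorem]) and Hauser's
  Kangaroo-Theorem conditions (1)–(3) ([cite: Hauser2010, p. 17]) at each certified increase;
* a DIMENSION-4 row found by the atlas' engine E2 (unit `pub-rosobs-eng2`): `x² + y² + z³ + w⁵`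
  over `𝔽₂`, point blow-ups at the origins of the charts `w`, `z`, `y`, then chart `y` at the point
  `(z, w) = (0, 1)`: shades `3, 2, 1, 1, 2`. At the last step (an increase) the kangaroo point lies
  ON the strict transform of the exceptional component `z = 0`, of multiplicity `1`, so the location
  clause (3) of the Kangaroo Theorem in the wording printed for `W = 𝔸^{1+m}` in
  [cite: Hauser2010, p. 18] evaluates to `false` there (`m = 3`), while conditions (6) and (7) of
  the general theorem [cite: HauserPerlega2019PRIMS, §3 Theorem] evaluate to `true`: the retained
  variable `z` occurs in the initial form `y z² w` only squared (for `m = 2`, (6) forces the point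
  to leave both components, which is (3)). Both evaluations are computations on this row; the
  comparison of the two printed statements is made in the atlas (AGREE.md), not here.

Conventions (those of the atlas, quoted from Hauser 2010 §F–§G): `F` is kept CLEANED (every
monomial all of whose exponents are divisible by `q` is removed — `x ↦ x + h(y)` over a perfect
field); exceptional multiplicities `r` accumulate by `D' = D^strict + (ord_a F − q)·Y'`, a
translation `y_i ↦ y_i + b_i` (`b_i ≠ 0`) leaves the component `y_i = 0`, so `r_i` is reset to
`0`; `shade = ord F_clean − Σ r_i`. A step is `(chart j, point b)`: `y_i ↦ y_i·y_j (i ≠ j)`,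
division by `y_j^q`, translation by `b`, then the equimultiplicity test `ord ≥ q` (a failing step
yields `none`).

This is a CERTIFICATE of finitely many computations, not a theorem about resolution.
-/

namespace Literature.AlgebraicGeometry.Resolution.KangarooAtlasCert

/-- exponent vector of a monomial in `y₁,…,y_m`. [folklore] -/
abbrev Mon := List ℕ
/-- sparse polynomial over `𝔽_p`: terms `(exponents, coefficient mod p)`. [folklore] -/
abbrev Poly := List (Mon × ℕ)

/-- total degree of a monomial. [folklore] -/
def deg (m : Mon) : ℕ := m.sum

/-- add one term to a normalised term list, coefficients mod `p`. [folklore] -/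
def addTerm (p : ℕ) (t : Mon × ℕ) : Poly → Poly
  | [] => if t.2 % p = 0 then [] else [(t.1, t.2 % p)]
  | (m, c) :: rest =>
      if m = t.1 then
        (if (c + t.2) % p = 0 then rest else (m, (c + t.2) % p) :: rest)
      else (m, c) :: addTerm p t rest

/-- collect equal monomials, drop zero coefficients (mod `p`). [folklore] -/
def normalize (p : ℕ) (P : Poly) : Poly := P.foldl (fun acc t => addTerm p t acc) []

/-- order at the origin (`0` for the zero polynomial, a value never used: callers test emptiness). [folklore] -/
def ord (P : Poly) : ℕ :=
  match P with
  | [] => 0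
  | t :: rest => rest.foldl (fun a s => min a (deg s.1)) (deg t.1)

/-- remove all `q`-th-power monomials: the cleaning `x ↦ x + h(y)` realising the shade over a perfect field. [cite: Hauser2010, §G] -/
def clean (q : ℕ) (P : Poly) : Poly := P.filter (fun t => t.1.any (fun e => e % q ≠ 0))

/-- point blow-up, chart `y_j`: `y_i ↦ y_i y_j` (`i ≠ j`), strict transform divided by `y_j^q`. [cite: Hauser2010, §G] -/
def blowup (j q : ℕ) (P : Poly) : Poly := P.map (fun t => (t.1.set j (deg t.1 - q), t.2))

/-- `y_i ↦ y_i + b` on one variable, by the binomial theorem (coefficients mod `p`). [folklore] -/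
def translateVar (p i b : ℕ) (P : Poly) : Poly :=
  normalize p (P.flatMap (fun t =>
    let n := t.1.getD i 0
    (List.range (n + 1)).map (fun k => (t.1.set i k, t.2 * Nat.choose n k * b ^ (n - k)))))

/-- translation `y ↦ y + b`, one variable at a time. [folklore] -/
def translate (p : ℕ) (b : List ℕ) (P : Poly) : Poly :=
  (List.range b.length).foldl (fun acc i => if b.getD i 0 = 0 then acc else translateVar p i (b.getD i 0) acc) P

/-- a state of the walk: the cleaned coefficient polynomial `F` and the accumulated exceptional multiplicities `r`
(`D' = D^strict + (ord_a F − q)·Y'`). [cite: Hauser2010, §F] -/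
structure State where
  F : Poly
  r : List ℕ
  deriving Repr, DecidableEq

/-- Hauser's shade `ord F_clean − Σ r_i`. [cite: Hauser2010, §F] -/
def shade (s : State) : ℕ := ord s.F - s.r.sum

/-- one blow-up step at `(chart j, point b)`; `none` if the point is not `q`-fold. [cite: Hauser2010, §G] -/
def step (p q : ℕ) (s : State) (j : ℕ) (b : List ℕ) : Option State :=
  let oF := ord s.F
  let rj := s.r.set j (oF - q)
  let G := translate p b (blowup j q s.F)
  if G.all (fun t => deg t.1 = 0 ∨ q ≤ deg t.1) then
    let Gc := clean q (G.filter (fun t => deg t.1 ≠ 0))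
    let rb := (List.range rj.length).map (fun i => if b.getD i 0 ≠ 0 then 0 else rj.getD i 0)
    some ⟨Gc, rb⟩
  else none

/-- shades along a scripted path (`none` once a step fails). [folklore] -/
def shades (p q : ℕ) (s : State) : List (ℕ × List ℕ) → List (Option ℕ)
  | [] => [some (shade s)]
  | (j, b) :: rest =>
      match step p q s j b with
      | none => [some (shade s), none]
      | some s' => some (shade s) :: shades p q s' rest

/-- Hauser's conditions (1)–(3) at the antelope `(r, shade)` for `q = p`, the kangaroo point lying on the
strict transforms of the old components listed in `on`. [cite: Hauser2010, p. 17 (Kangaroo Theorem)] -/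
def hauserConditions (p : ℕ) (r : List ℕ) (sh : ℕ) (on : List ℕ) : Bool :=
  let phi := (r.filter (fun ri => ri % p ≠ 0)).length
  ((r.sum + sh) % p = 0) && ((r.map (fun ri => ri % p)).sum ≤ (phi - 1) * p) && on.all (fun i => r.getD i 0 % p = 0)

/-! ## Certified rows -/

/-- Hauser's example `x² + y⁷ + yz⁴`, `p = 2`, variables `(y, z)`; `F` already clean. [cite: Hauser2010, §G] -/
def hauserF : Poly := [([7, 0], 1), ([1, 4], 1)]
/-- Hauser's printed path: chart `y` at the origin, chart `z` at the origin, chart `y` at `z = 1`. [cite: Hauser2010, §G] -/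
def hauserPath : List (ℕ × List ℕ) := [(0, [0, 0]), (1, [0, 0]), (0, [0, 1])]

/-- shades `5, 2, 2, 3` along the printed path. [cite: Hauser2010, §G] -/
theorem hauser_shades : shades 2 2 ⟨hauserF, [0, 0]⟩ hauserPath = [some 5, some 2, some 2, some 3] := by
  decide

/-- the antelope state reached after two steps is `y³z³(y² + z²)` with `r = (3, 3)`. [cite: Hauser2010, §G] -/
theorem hauser_antelope :
    (step 2 2 ⟨hauserF, [0, 0]⟩ 0 [0, 0]).bind (fun s => step 2 2 s 1 [0, 0]) =
      some ⟨[([5, 3], 1), ([3, 5], 1)], [3, 3]⟩ := by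
  decide

/-- the kangaroo state: `y⁶z³ + y⁶z⁵` (after cleaning `y⁶z⁴`, i.e. Hauser's `x ↦ x + yz³` in his coordinates), `r = (6, 0)`, shade `3`. [cite: Hauser2010, §G] -/
theorem hauser_kangaroo :
    step 2 2 ⟨[([5, 3], 1), ([3, 5], 1)], [3, 3]⟩ 0 [0, 1] = some ⟨[([6, 3], 1), ([6, 5], 1)], [6, 0]⟩ := by
  decide

/-- Moh's bound at the increase: `3 ≤ 2 + 2^0`. [cite: Moh1987, Stability Theorem] -/
theorem hauser_moh : shade ⟨[([6, 3], 1), ([6, 5], 1)], [6, 0]⟩ ≤ shade ⟨[([5, 3], 1), ([3, 5], 1)], [3, 3]⟩ + 1 := by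
  decide

/-- Hauser's (1)–(3) at the antelope `r = (3,3)`, shade `2`, kangaroo point off both old components. [cite: Hauser2010, p. 17] -/
theorem hauser_conditions : hauserConditions 2 [3, 3] 2 [] = true := by decide

/-- zoo row `iso-p2-y3z+yz3-r11`: `x² + y³z + yz³`, prescribed history `r₀ = (1, 1)`, `p = 2`:
shade `2 → 3` at chart `y`, point `z = 1`; the antelope's coordinate top locus is the point alone (atlas row, computation). [folklore] -/
theorem iso_p2_shades : shades 2 2 ⟨[([3, 1], 1), ([1, 3], 1)], [1, 1]⟩ [(0, [0, 1])] = [some 2, some 3] := by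
  decide

/-- the antelope of `iso-p2`: no coordinate line is equimultiple with the same shade
(`ord` along `{y = 0}` is `1 < 2`, along `{z = 0}` is `1 < 2`) — checked on the exponent lists. [folklore] -/
theorem iso_p2_isolated :
    ((([([3, 1], 1), ([1, 3], 1)] : Poly).map (fun t => t.1.getD 0 0)).foldl min 3 < 2) ∧
    ((([([3, 1], 1), ([1, 3], 1)] : Poly).map (fun t => t.1.getD 1 0)).foldl min 3 < 2) := by
  decide

/-- zoo row `iso-p3-r12`: `x³ + yz⁵ + y⁴z²`, `r₀ = (1, 2)`, `p = 3`: shade `3 → 4` at chart `y`, point `z = 2` (atlas row, computation). [folklore] -/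
theorem iso_p3_shades : shades 3 3 ⟨[([1, 5], 1), ([4, 2], 1)], [1, 2]⟩ [(0, [0, 2])] = [some 3, some 4] := by
  decide

/-- Hauser's (1)–(3) at the antelope of `iso-p3-r12`. [cite: Hauser2010, p. 17] -/
theorem iso_p3_conditions : hauserConditions 3 [1, 2] 3 [] = true := by decide

/-- a NON-kangaroo control: Hauser's path with the third point replaced by the origin of chart `y` drops `2 → 0`
(the monomial case: `F = y⁶ z³ (…)`, shade `0`). [cite: Hauser2010, §G] -/
theorem hauser_control : shades 2 2 ⟨hauserF, [0, 0]⟩ [(0, [0, 0]), (1, [0, 0]), (0, [0, 0])] = [some 5, some 2, some 2, some 0] := by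
  decide

/-! ## A dimension-4 row: `x² + y² + z³ + w⁵` over `𝔽₂` (variables `(y, z, w)`, `q = p = 2`) -/

/-- `F = z³ + w⁵` (the monomial `y²` is removed by the cleaning `x ↦ x + y`), no history. (atlas row `bp-p2-y2z3w5`, computation) [folklore] -/
def e8F : Poly := [([0, 3, 0], 1), ([0, 0, 5], 1)]

/-- the path: origins of the charts `w`, `z`, `y`, then chart `y` at `(z, w) = (0, 1)`. (computation) [folklore] -/
def e8Path : List (ℕ × List ℕ) := [(2, [0, 0, 0]), (1, [0, 0, 0]), (0, [0, 0, 0]), (0, [0, 0, 1])]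

/-- shades `3, 2, 1, 1, 2` along the path: every step is equimultiple and the last one is an increase. (computation) [folklore] -/
theorem e8_shades : shades 2 2 ⟨e8F, [0, 0, 0]⟩ e8Path = [some 3, some 2, some 1, some 1, some 2] := by
  decide

/-- the antelope after three steps: `F = y z² w + y² z w³`, `r = (1, 1, 1)`, shade `4 − 3 = 1`. (computation) [folklore] -/
theorem e8_antelope :
    (((step 2 2 ⟨e8F, [0, 0, 0]⟩ 2 [0, 0, 0]).bind (fun s => step 2 2 s 1 [0, 0, 0])).bind
        (fun s => step 2 2 s 0 [0, 0, 0])) =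
      some ⟨[([1, 2, 1], 1), ([2, 1, 3], 1)], [1, 1, 1]⟩ := by
  decide

/-- the kangaroo: chart `y`, `w ↦ w + 1`; after removing the square `y²z²`,
`F' = y²z²w + y⁴z + y⁴zw + y⁴zw² + y⁴zw³`, `r' = (2, 1, 0)`, shade `5 − 3 = 2 > 1`;
`r'_z = 1`: the point lies on the strict transform of `z = 0`. (computation) [folklore] -/
theorem e8_kangaroo :
    step 2 2 ⟨[([1, 2, 1], 1), ([2, 1, 3], 1)], [1, 1, 1]⟩ 0 [0, 0, 1] =
      some ⟨[([2, 2, 1], 1), ([4, 1, 0], 1), ([4, 1, 1], 1), ([4, 1, 2], 1), ([4, 1, 3], 1)], [2, 1, 0]⟩ := by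
  decide

/-- Moh's bound at this increase: `2 ≤ 1 + 2^0`. [cite: Moh1987, Stability Theorem] -/
theorem e8_moh :
    shade ⟨[([2, 2, 1], 1), ([4, 1, 0], 1), ([4, 1, 1], 1), ([4, 1, 2], 1), ([4, 1, 3], 1)], [2, 1, 0]⟩ ≤
      shade ⟨[([1, 2, 1], 1), ([2, 1, 3], 1)], [1, 1, 1]⟩ + 1 := by
  decide

/-- conditions (1) and (2) of [cite: Hauser2010, p. 17] hold at the antelope `r = (1,1,1)`, shade `1`
(`4 ≡ 0 mod 2`; `1+1+1 ≤ (3−1)·2`) … -/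
theorem e8_conditions12 : hauserConditions 2 [1, 1, 1] 1 [] = true := by decide

/-- … but with the location clause (3) as printed in [cite: Hauser2010, p. 18] for `W = 𝔸^{1+m}` — the kangaroo point
lies on none of the strict transforms of the components `y_i = 0` with `r_i ≢ 0 mod p` — the conjunction is `false`
here: the point stays on `z = 0` (index `1`) and `r_z = 1`. (computation on this row) -/
theorem e8_literal3_false : hauserConditions 2 [1, 1, 1] 1 [1] = false := by decide

/-- Hauser–Perlega's condition (7) for a POINT blow-up in chart `j` at translation vector `b`, in the case (the one
of this row) where the chart variable and every translated variable are exceptional, so that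
`T = {j} ∪ {i : b_i ≠ 0}` needs no re-charting or absorption: every variable NOT in `T` occurs in the initial
form of `F` only with exponents divisible by `q`. [cite: HauserPerlega2019PRIMS, §3 Theorem (7)] -/
def hpCond7 (q : ℕ) (F : Poly) (j : ℕ) (b : List ℕ) : Bool :=
  let o := ord F
  (F.filter (fun t => deg t.1 = o)).all
    (fun t => (List.range t.1.length).all (fun i => i = j || b.getD i 0 != 0 || t.1.getD i 0 % q == 0))

/-- Hauser–Perlega's residue inequality (6) in the same case and with `ℓ = 0` (initial form not a `p`-th power,
`e = 1`): with `r_i` the least exponent of `x_i` in the initial form (`i ∈ T`) and `b` the number of those not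
divisible by `p`, `Σ_{i∈T} (r_i mod p) ≤ (b − 1)·p` (over `ℤ`, so that `b = 0` is correctly infeasible).
[cite: HauserPerlega2019PRIMS, §3 Theorem (6)] -/
def hpCond6 (p : ℕ) (F : Poly) (j : ℕ) (b : List ℕ) : Bool :=
  let o := ord F
  let init := F.filter (fun t => deg t.1 = o)
  let m := ((F.headD ([], 0)).1).length
  let T := (List.range m).filter (fun i => i = j || b.getD i 0 != 0)
  let rT := T.map (fun i => (init.map (fun t => t.1.getD i 0)).foldl min o)
  let cnt := (rT.filter (fun x => x % p != 0)).length
  decide ((((rT.map (fun x => x % p)).sum : ℕ) : ℤ) ≤ ((cnt : ℤ) - 1) * (p : ℤ))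

/-- (7) holds at the dimension-4 antelope for chart `y`, point `(z, w) = (0, 1)`: `T = {y, w}`, and `z` occurs in the
initial form `y z² w` squared. (computation) [cite: HauserPerlega2019PRIMS, §3 Theorem (7)] -/
theorem e8_hp7 : hpCond7 2 [([1, 2, 1], 1), ([2, 1, 3], 1)] 0 [0, 0, 1] = true := by decide

/-- (6) holds there: `r_T = (1, 1)`, `b = 2`, `1 + 1 ≤ (2 − 1)·2`. (computation) [cite: HauserPerlega2019PRIMS, §3 Theorem (6)] -/
theorem e8_hp6 : hpCond6 2 [([1, 2, 1], 1), ([2, 1, 3], 1)] 0 [0, 0, 1] = true := by decide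

/-- control: for a surface (`m = 2`) a point that stays on the second component has `T = {j}` and (6) is
infeasible — e.g. at Hauser's antelope `y³z³(y²+z²)`, chart `y`, ORIGIN (`b = 0`): `false`; at his kangaroo
point `z = 1`: `true`. (computation) [cite: HauserPerlega2019PRIMS, §3 Theorem (6)] -/
theorem hauser_hp6 :
    hpCond6 2 [([5, 3], 1), ([3, 5], 1)] 0 [0, 0] = false ∧ hpCond6 2 [([5, 3], 1), ([3, 5], 1)] 0 [0, 1] = true := by
  decide

end Literature.AlgebraicGeometry.Resolution.KangarooAtlasCert
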